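import Literature.Geometry.Kaehler.ComplexTorusTrivialBundleSerrePairing
import HarnessLib

/-!
# The basis `{[dv̄_I] : #I = q}` of `H^{0,q}_{∂̄}(X, 𝒪_X)` for a complex torus (Lange §1.6.4 Exercise (1), explicit)

Layer `Literature/Geometry/Kaehler`, namespace `Literature.Geometry.Kaehler.ComplexTorus`; lane
`lit-hodgefound` (Layer A2, seat `lit-hodgefound-skel-2`, generation 24), RIDER §7 of row **A2-83**
(`ComplexTorusTrivialBundleHodgeDecomposition`). Two DEFINITIONS WITH BODIES (the linear equivalence
`dbarCohomologyOneEquiv` and the basis `dbarCohomologyOneBasis`) and THEOREMS; no named fact, no `sorry`.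

H. Lange, *Abelian Varieties over the Complex Numbers* (2023), held `book:lange1992-complex-abelian-varieties`,
§1.6.4 Exercise (1) [p0071]: "For any complex torus `X` compute the cohomology groups of the trivial line bundle
`𝒪_X`." — with §1.1.5 Thm. 1.1.21 (b) / Cor. 1.1.22 [p0024–p0025]: `H^q(X, 𝒪_X) ≅ ⋀^q Ω̄`, `Ω̄ = Hom_{ℂ-antilinear}(V, ℂ)`
with basis `dv̄_1, …, dv̄_g`. D. Huybrechts, *Complex Geometry* (2005), Cor. 4.1.14 [p0199] (every class has a
unique harmonic representative). Row A2-83 proved, on row A2-79's coefficient-family carrier, that the harmonic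
`𝒪_X`-valued `(0,q)`-families are exactly the CONSTANT families and that every Dolbeault class has exactly one
harmonic representative (`harmonicToDolbeault_one_bijective`, `harmonicFormsOneEquiv`). This rider spells the
answer to the exercise out as a BASIS:

* `dbarCohomologyOneEquiv : ({I : Finset (Fin g) // #I = q} → ℂ) ≃ₗ[ℂ] H^{0,q}_{∂̄}(X, 𝒪_X)`,
  `c ↦ [Σ_{#I = q} c_I dv̄_I]` (`dbarCohomologyOneEquiv_apply`);
* **`dbarCohomologyOneBasis : Basis {I // #I = q} ℂ (H^{0,q}_{∂̄}(X, 𝒪_X))`, `I ↦ [dv̄_I]`** — the class of the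
  constant indicator family (`dbarCohomologyOneBasis_apply`); so `H^{0,q}_{∂̄}(X, 𝒪_X) = ⊕_{#I=q} ℂ·[dv̄_I]`
  (every spanning frame of `g` vectors, all positive auxiliary weights), and every class is `[Σ_I c_I dv̄_I]` for a
  unique constant vector `c` (`existsUnique_constFamily_mk_eq`).

## References

* [Lange2023AbelianVarietiesComplex] H. Lange, *Abelian Varieties over the Complex Numbers* (2023), §1.1.5
  Thm. 1.1.21, Cor. 1.1.22 (p0024–p0025), §1.6.4 Exercise (1) (p0071).
* [HuybrechtsCG2005] D. Huybrechts, *Complex Geometry. An Introduction* (2005), §4.1 Cor. 4.1.14 (p. 170).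
-/

noncomputable section

open scoped Manifold ContDiff Topology Real ComplexConjugate
open Set Function Complex Finset Module

namespace Literature.Geometry.Kaehler

namespace ComplexTorus

variable {ι : Type*} [Fintype ι] [DecidableEq ι] {E : Type*} [NormedAddCommGroup E] [NormedSpace ℂ E]
  {Φ : (ι → ℝ) ≃L[ℝ] E} {g : ℕ} {b : Fin g → E} {k : Fin g → ℝ}
  (hspan : Submodule.span ℂ (Set.range b) = ⊤) (hk : ∀ ν, 0 < k ν)
include hspan hk

/-- **`ℂ^{(q-subsets)} ≅ H^{0,q}_{∂̄}(X, 𝒪_X)`, `c ↦ [Σ_{#I=q} c_I dv̄_I]`** — constants `≅ ℋ^q(𝒪_X)` (row A2-83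
`harmonicFormsOneEquiv`) followed by Thm. 1.6.1's bijection `ℋ^q(𝒪_X) ≅ H^{0,q}_{∂̄}` (`harmonicToDolbeault_one_bijective`).
[cite: Lange2023AbelianVarietiesComplex, §1.6.4 Exercise (1)] [cite: HuybrechtsCG2005, §4.1 Cor. 4.1.14] -/
def dbarCohomologyOneEquiv (q : ℕ) : ({I : Finset (Fin g) // I.card = q} → ℂ) ≃ₗ[ℂ] dbarCohomology Φ 0 1 b q :=
  (harmonicFormsOneEquiv hspan hk q).symm.trans
    (LinearEquiv.ofBijective _ (harmonicToDolbeault_one_bijective hspan hk q))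

omit [DecidableEq ι] hspan hk in
/-- The constant family with coefficients `c` supported on `q`-subsets is `∂̄`-closed of degree `q`.
[cite: Lange2023AbelianVarietiesComplex, §1.6.4 Exercise (1)] -/
theorem constFamily_dite_mem_dbarClosedForms (q : ℕ) (c : {I : Finset (Fin g) // I.card = q} → ℂ) :
    constFamily (E := E) (fun J ↦ if h : J.card = q then c ⟨J, h⟩ else 0) ∈ dbarClosedForms Φ 0 1 b q :=
  constFamily_mem_dbarClosedForms Φ b fun J hJ ↦ by rw [dif_neg hJ]

/-- **`dbarCohomologyOneEquiv c = [Σ_{#I=q} c_I dv̄_I]`** (the class of the constant family).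
[cite: Lange2023AbelianVarietiesComplex, §1.6.4 Exercise (1)] -/
theorem dbarCohomologyOneEquiv_apply (q : ℕ) (c : {I : Finset (Fin g) // I.card = q} → ℂ) :
    dbarCohomologyOneEquiv hspan hk q c =
      dbarCohomology.mk Φ 0 1 b q ⟨constFamily fun J ↦ if h : J.card = q then c ⟨J, h⟩ else 0,
        constFamily_dite_mem_dbarClosedForms q c⟩ := by
  rw [dbarCohomologyOneEquiv, LinearEquiv.trans_apply, LinearEquiv.ofBijective_apply,
    (isNSForm_zero Φ).harmonicToDolbeault_apply]
  rfl

/-- **THE BASIS `{[dv̄_I] : #I = q}` OF `H^{0,q}_{∂̄}(X, 𝒪_X)`** (Lange §1.6.4 Exercise (1) made explicit on row A2-79's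
carrier: `H^q(X, 𝒪_X) = ⊕_{#I = q} ℂ·dv̄_I`, cf. Cor. 1.1.22). [cite: Lange2023AbelianVarietiesComplex, §1.6.4 Exercise (1)]
[cite: Lange2023AbelianVarietiesComplex, §1.1.5 Cor. 1.1.22] -/
def dbarCohomologyOneBasis (q : ℕ) : Module.Basis {I : Finset (Fin g) // I.card = q} ℂ (dbarCohomology Φ 0 1 b q) :=
  (Pi.basisFun ℂ {I : Finset (Fin g) // I.card = q}).map (dbarCohomologyOneEquiv hspan hk q)

omit [DecidableEq ι] hspan hk in
/-- The indicator constant family `dv̄_I` is `∂̄`-closed of degree `#I`. [cite: Lange2023AbelianVarietiesComplex, §1.6.4 Exercise (1)] -/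
theorem constFamily_indicator_mem_dbarClosedForms (q : ℕ) (I : {I : Finset (Fin g) // I.card = q}) :
    constFamily (E := E) (fun J ↦ if J = I.1 then (1 : ℂ) else 0) ∈ dbarClosedForms Φ 0 1 b q :=
  constFamily_mem_dbarClosedForms Φ b fun J hJ ↦ by
    rw [if_neg]
    rintro rfl
    exact hJ I.2

/-- **`dbarCohomologyOneBasis I = [dv̄_I]`**: the `I`-th basis vector is the class of the constant indicator family
`J ↦ [J = I]`. [cite: Lange2023AbelianVarietiesComplex, §1.6.4 Exercise (1)] -/
theorem dbarCohomologyOneBasis_apply (q : ℕ) (I : {I : Finset (Fin g) // I.card = q}) :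
    dbarCohomologyOneBasis hspan hk q I =
      dbarCohomology.mk Φ 0 1 b q ⟨constFamily fun J ↦ if J = I.1 then (1 : ℂ) else 0,
        constFamily_indicator_mem_dbarClosedForms q I⟩ := by
  rw [dbarCohomologyOneBasis, Module.Basis.map_apply, Pi.basisFun_apply, dbarCohomologyOneEquiv_apply]
  congr 2
  funext J v
  simp only [constFamily_apply]
  by_cases hJ : J.card = q
  · rw [dif_pos hJ, Pi.single_apply]
    by_cases hJI : J = I.1
    · subst hJI
      simp
    · rw [if_neg hJI, if_neg]
      intro h
      exact hJI (congrArg Subtype.val h)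
  · rw [dif_neg hJ, if_neg]
    rintro rfl
    exact hJ I.2

/-- **Every class in `H^{0,q}_{∂̄}(X, 𝒪_X)` is `[Σ_{#I=q} c_I dv̄_I]` for a UNIQUE constant vector `c`.**
[cite: Lange2023AbelianVarietiesComplex, §1.6.4 Exercise (1)] [cite: HuybrechtsCG2005, §4.1 Cor. 4.1.14] -/
theorem existsUnique_constFamily_mk_eq (q : ℕ) (x : dbarCohomology Φ 0 1 b q) :
    ∃! c : {I : Finset (Fin g) // I.card = q} → ℂ,
      dbarCohomology.mk Φ 0 1 b q ⟨constFamily fun J ↦ if h : J.card = q then c ⟨J, h⟩ else 0,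
        constFamily_dite_mem_dbarClosedForms q c⟩ = x := by
  refine ⟨(dbarCohomologyOneEquiv hspan hk q).symm x, ?_, fun c hc ↦ ?_⟩
  · show dbarCohomology.mk Φ 0 1 b q _ = x
    rw [← dbarCohomologyOneEquiv_apply hspan hk, LinearEquiv.apply_symm_apply]
  · have hc' : dbarCohomologyOneEquiv hspan hk q c = x := by rw [dbarCohomologyOneEquiv_apply]; exact hc
    rw [← hc', LinearEquiv.symm_apply_apply]

/-- The coordinates of a class in the basis `{[dv̄_I]}` are given by `dbarCohomologyOneEquiv⁻¹`.
[cite: Lange2023AbelianVarietiesComplex, §1.6.4 Exercise (1)] -/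
theorem dbarCohomologyOneBasis_repr (q : ℕ) (x : dbarCohomology Φ 0 1 b q) (I : {I : Finset (Fin g) // I.card = q}) :
    (dbarCohomologyOneBasis hspan hk q).repr x I = (dbarCohomologyOneEquiv hspan hk q).symm x I := by
  rw [dbarCohomologyOneBasis, Module.Basis.map_repr, LinearEquiv.trans_apply, Pi.basisFun_repr]

end ComplexTorus

end Literature.Geometry.Kaehler
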